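import Literature.NumberTheory.Sieve.DrappeauDispersionCompletionInputs
import Literature.NumberTheory.Sieve.DrappeauDispersionMainTerms
import HarnessLib

/-!
# Drappeau 2017, §5.4–5.5: Poisson summation for `𝒮₁` — the identity `𝒮₁ = α̂(0) X₁ + ℛ₁`

Topic `Literature/NumberTheory/Sieve`, part of the formalisation of §5 of S. Drappeau, Proc. London
Math. Soc. (3) 114 (2017) 684–732 = arXiv:1504.05549 (Theorem 5.1 = the named fact
`Literature.NumberTheory.Sieve.Drappeau2017_theorem51`; the tree has `Drappeau2017_theorem51_of_S1`
reducing it to the estimate `|𝒮₁ − A₀X₁| ≪ MN²(log x)^{O(1)}R^{−2}` of §5.4–5.5).  Everything here is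
PROVED; no definition and no named fact is introduced.

§5.4 (arXiv p. 19): `𝒮₁ = ∑_{(q₁q₂,a₁a₂)=1} γ(q₁)γ(q₂) ∑_{(n_j,q_ja₂)=1, n₁≡n₂ ((q₁,q₂))} β_{n₁}β̄_{n₂}
∑_{m ≡ a₁\\overline{a₂n_j} (q_j)} α(m)`, with expected main term `α̂(0) X₁` (5.20); §5.5: "Using
Poisson summation, we have `𝒮₁ = α̂(0)X₁ + ℛ₁ + …`" with
`ℛ₁ = ∑ γγββ̄ ∑_{h≠0} W⁻¹ α̂(h/W) e(hμ/W)`, `W = [q₁,q₂]`, `μ` the common solution of the two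
congruences.  For the tree's objects (`dispS1`, `mainX1` of `DrappeauDispersionSkeleton` /
`DrappeauDispersionMainTerms`, the majorant `α = BFI.bump M (M/2)` and `A₀ = ∑_m α(m)`, which by
Poisson summation absorbs the frequencies `h ∈ Wℤ`) we prove the EXACT identity
`Drappeau2017.dispS1_eq_mainX1_add_freq`:

  `𝒮₁ = A₀ X₁ + ∑_{q₁,q₂} γ(q₁)γ(q₂) ∑_{n₁,n₂} β_{n₁}β̄_{n₂} (M/W) ∑_{b mod W : b n_j a₂ ≡ a₁ (q_j)}
        ∑_{h ∈ ℤ ∖ Wℤ} ψ̂(Mh/W) e(bh/W)`,   `ψ = BFI.bumpC 1 (1/2)` (`α(m) = ψ(m/M)`),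

where the `b`-sum has at most one term (`b = μ`), present exactly when `(n_j, q_j) = 1` and
`n₁ ≡ n₂ (mod (q₁,q₂))` (`Drappeau2017.card_range_lcm_filter_eq`, the Chinese remainder theorem for
the moduli `q₁, q₂`).  Ingredients: `Polymath8a.completion_identity` (Poisson summation along a
progression, `SmoothCompletionOfSums`) and the bridge `tsum_bumpC_mul_eq_sum_mRange`
(`DrappeauDispersionCompletionInputs`).

## References

* S. Drappeau, Proc. London Math. Soc. (3) 114 (2017) 684–732, arXiv:1504.05549, §5.4 (5.20), §5.5
  (the display `𝒮₁(q₀,n₀) = α̂(0)X₁(q₀,n₀) + ℛ₁ + O(x^ε ℛ₂)`). [cite: Drappeau2017, §5.4–5.5]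
* D. H. J. Polymath, Algebra & Number Theory 8 (2014), Lemma 4.9 (completion of sums).
  [cite: Polymath8a2014, Lemma 4.9]
-/

noncomputable section

open Finset Real Complex MeasureTheory
open scoped FourierTransform ContDiff

namespace Literature.NumberTheory.Sieve

namespace Drappeau2017

/-! ### The Chinese remainder count for the moduli `q₁, q₂` -/

/-- Two naturals `< [q₁,q₂]` that agree modulo `q₁` and modulo `q₂` are equal. [folklore] -/
theorem eq_of_cast_eq_of_lt_lcm {q₁ q₂ b b' : ℕ} (hb : b < Nat.lcm q₁ q₂) (hb' : b' < Nat.lcm q₁ q₂)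
    (h₁ : (b : ZMod q₁) = (b' : ZMod q₁)) (h₂ : (b : ZMod q₂) = (b' : ZMod q₂)) : b = b' := by
  rw [ZMod.natCast_eq_natCast_iff] at h₁ h₂
  -- `q₁ ∣ |b - b'|`, `q₂ ∣ |b - b'|`
  have hd : ∀ {q : ℕ}, b ≡ b' [MOD q] → q ∣ Int.natAbs ((b : ℤ) - b') := by
    intro q h
    have := (Nat.modEq_iff_dvd.1 h)
    rw [Int.natCast_dvd] at this
    rwa [← Int.natAbs_neg, neg_sub]
  have hW : Nat.lcm q₁ q₂ ∣ Int.natAbs ((b : ℤ) - b') := Nat.lcm_dvd (hd h₁) (hd h₂)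
  have hlt : Int.natAbs ((b : ℤ) - b') < Nat.lcm q₁ q₂ := by
    zify
    rw [abs_sub_lt_iff]
    constructor <;> linarith
  have h0 := Nat.eq_zero_of_dvd_of_lt hW hlt
  omega

/-- **CRT count.** For `q₁,q₂ ≥ 1`, `a₁, a₂` units modulo `q₁` and `q₂`, and naturals `n₁, n₂`:
`#{b < [q₁,q₂] : b n₁a₂ ≡ a₁ (q₁), b n₂a₂ ≡ a₁ (q₂)} = 1` if `(n₁,q₁) = (n₂,q₂) = 1` and
`n₁ ≡ n₂ (mod (q₁,q₂))`, and `= 0` otherwise. [folklore] -/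
theorem card_range_lcm_filter_eq {q₁ q₂ : ℕ} (hq₁ : 0 < q₁) (hq₂ : 0 < q₂) {a₁ a₂ : ℤ}
    (ha₁ : IsUnit (a₁ : ZMod q₁)) (ha₁' : IsUnit (a₁ : ZMod q₂))
    (ha₂ : IsUnit (a₂ : ZMod q₁)) (ha₂' : IsUnit (a₂ : ZMod q₂)) (n₁ n₂ : ℕ) :
    ((Finset.range (Nat.lcm q₁ q₂)).filter (fun b : ℕ =>
        (b : ZMod q₁) * ((n₁ : ZMod q₁) * (a₂ : ZMod q₁)) = (a₁ : ZMod q₁) ∧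
        (b : ZMod q₂) * ((n₂ : ZMod q₂) * (a₂ : ZMod q₂)) = (a₁ : ZMod q₂))).card =
      if (n₁.Coprime q₁ ∧ n₂.Coprime q₂ ∧
          (n₁ : ZMod (Nat.gcd q₁ q₂)) = (n₂ : ZMod (Nat.gcd q₁ q₂))) then 1 else 0 := by
  haveI : NeZero q₁ := ⟨hq₁.ne'⟩
  haveI : NeZero q₂ := ⟨hq₂.ne'⟩
  set W := Nat.lcm q₁ q₂ with hWdef
  set g := Nat.gcd q₁ q₂ with hgdef
  haveI : NeZero g := ⟨(Nat.gcd_pos_of_pos_left _ hq₁).ne'⟩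
  set B := (Finset.range W).filter (fun b : ℕ =>
        (b : ZMod q₁) * ((n₁ : ZMod q₁) * (a₂ : ZMod q₁)) = (a₁ : ZMod q₁) ∧
        (b : ZMod q₂) * ((n₂ : ZMod q₂) * (a₂ : ZMod q₂)) = (a₁ : ZMod q₂)) with hBdef
  -- the castHom to `ZMod g`
  let π₁ : ZMod q₁ →+* ZMod g := ZMod.castHom (Nat.gcd_dvd_left q₁ q₂) (ZMod g)
  let π₂ : ZMod q₂ →+* ZMod g := ZMod.castHom (Nat.gcd_dvd_right q₁ q₂) (ZMod g)
  have hπ₁n : ∀ k : ℕ, π₁ (k : ZMod q₁) = (k : ZMod g) := fun k => map_natCast π₁ k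
  have hπ₂n : ∀ k : ℕ, π₂ (k : ZMod q₂) = (k : ZMod g) := fun k => map_natCast π₂ k
  have hπ₁i : ∀ k : ℤ, π₁ (k : ZMod q₁) = (k : ZMod g) := fun k => map_intCast π₁ k
  have hπ₂i : ∀ k : ℤ, π₂ (k : ZMod q₂) = (k : ZMod g) := fun k => map_intCast π₂ k
  -- uniqueness
  have huniq : ∀ b ∈ B, ∀ b' ∈ B, b = b' := by
    intro b hb b' hb'
    rw [hBdef, Finset.mem_filter, Finset.mem_range] at hb hb'
    have hu₁ : IsUnit ((n₁ : ZMod q₁) * (a₂ : ZMod q₁)) := by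
      have h := hb.2.1 ▸ ha₁
      exact isUnit_of_mul_isUnit_right h
    have hu₂ : IsUnit ((n₂ : ZMod q₂) * (a₂ : ZMod q₂)) := by
      have h := hb.2.2 ▸ ha₁'
      exact isUnit_of_mul_isUnit_right h
    refine eq_of_cast_eq_of_lt_lcm hb.1 hb'.1 ?_ ?_
    · have h := hb.2.1.trans hb'.2.1.symm
      exact (IsUnit.mul_left_inj hu₁).1 h
    · have h := hb.2.2.trans hb'.2.2.symm
      exact (IsUnit.mul_left_inj hu₂).1 h
  by_cases hc : (n₁.Coprime q₁ ∧ n₂.Coprime q₂ ∧ (n₁ : ZMod g) = (n₂ : ZMod g))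
  · rw [if_pos hc]
    obtain ⟨hc₁, hc₂, hc₃⟩ := hc
    -- the residues `c_j = a₁ (n_j a₂)⁻¹`
    have hu₁ : IsUnit ((n₁ : ZMod q₁) * (a₂ : ZMod q₁)) :=
      ((ZMod.isUnit_iff_coprime n₁ q₁).2 hc₁).mul ha₂
    have hu₂ : IsUnit ((n₂ : ZMod q₂) * (a₂ : ZMod q₂)) :=
      ((ZMod.isUnit_iff_coprime n₂ q₂).2 hc₂).mul ha₂'
    set c₁ : ZMod q₁ := (a₁ : ZMod q₁) * ((n₁ : ZMod q₁) * (a₂ : ZMod q₁))⁻¹ with hc₁def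
    set c₂ : ZMod q₂ := (a₁ : ZMod q₂) * ((n₂ : ZMod q₂) * (a₂ : ZMod q₂))⁻¹ with hc₂def
    have hc₁eq : c₁ * ((n₁ : ZMod q₁) * (a₂ : ZMod q₁)) = (a₁ : ZMod q₁) := by
      rw [hc₁def, mul_assoc, ZMod.inv_mul_of_unit _ hu₁, mul_one]
    have hc₂eq : c₂ * ((n₂ : ZMod q₂) * (a₂ : ZMod q₂)) = (a₁ : ZMod q₂) := by
      rw [hc₂def, mul_assoc, ZMod.inv_mul_of_unit _ hu₂, mul_one]
    clear_value c₁ c₂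
    -- compatibility modulo `g`
    have hcompat : π₁ c₁ = π₂ c₂ := by
      have e₁ : π₁ c₁ * ((n₁ : ZMod g) * (a₂ : ZMod g)) = (a₁ : ZMod g) := by
        have := congrArg π₁ hc₁eq
        simpa only [map_mul, hπ₁n, hπ₁i] using this
      have e₂ : π₂ c₂ * ((n₁ : ZMod g) * (a₂ : ZMod g)) = (a₁ : ZMod g) := by
        have := congrArg π₂ hc₂eq
        simpa only [map_mul, hπ₂n, hπ₂i, ← hc₃] using this
      have hu : IsUnit ((n₁ : ZMod g) * (a₂ : ZMod g)) := by
        have := congrArg π₁ (ZMod.mul_inv_of_unit _ hu₁)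
        simp only [map_mul, map_one, hπ₁n, hπ₁i] at this
        exact IsUnit.of_mul_eq_one _ this
      exact (IsUnit.mul_left_inj hu).1 (e₁.trans e₂.symm)
    have hval : c₁.val ≡ c₂.val [MOD g] := by
      rw [← ZMod.natCast_eq_natCast_iff]
      have e₁ : ((c₁.val : ℕ) : ZMod g) = π₁ c₁ := by
        rw [ZMod.natCast_val]; rfl
      have e₂ : ((c₂.val : ℕ) : ZMod g) = π₂ c₂ := by
        rw [ZMod.natCast_val]; rfl
      rw [e₁, e₂, hcompat]
    obtain ⟨k, hk₁, hk₂⟩ := Nat.chineseRemainder' hval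
    have hW : 0 < W := Nat.lcm_pos hq₁ hq₂
    set b := k % W with hbdef
    have hbk₁ : (b : ZMod q₁) = c₁ := by
      have h1 : b ≡ k [MOD q₁] := (Nat.mod_modEq k W).of_dvd (Nat.dvd_lcm_left q₁ q₂)
      rw [(ZMod.natCast_eq_natCast_iff _ _ _).2 (h1.trans hk₁), ZMod.natCast_zmod_val]
    have hbk₂ : (b : ZMod q₂) = c₂ := by
      have h1 : b ≡ k [MOD q₂] := (Nat.mod_modEq k W).of_dvd (Nat.dvd_lcm_right q₁ q₂)
      rw [(ZMod.natCast_eq_natCast_iff _ _ _).2 (h1.trans hk₂), ZMod.natCast_zmod_val]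
    have hbmem : b ∈ B := by
      rw [hBdef, Finset.mem_filter, Finset.mem_range]
      exact ⟨Nat.mod_lt _ hW, by rw [hbk₁, hc₁eq], by rw [hbk₂, hc₂eq]⟩
    rw [Finset.card_eq_one]
    exact ⟨b, Finset.eq_singleton_iff_unique_mem.2 ⟨hbmem, fun b' hb' => huniq b' hb' b hbmem⟩⟩
  · rw [if_neg hc, Finset.card_eq_zero, hBdef, Finset.filter_eq_empty_iff]
    intro b _ hb
    apply hc
    have hu₁ : IsUnit ((n₁ : ZMod q₁) * (a₂ : ZMod q₁)) :=
      isUnit_of_mul_isUnit_right (hb.1 ▸ ha₁)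
    have hu₂ : IsUnit ((n₂ : ZMod q₂) * (a₂ : ZMod q₂)) :=
      isUnit_of_mul_isUnit_right (hb.2 ▸ ha₁')
    refine ⟨(ZMod.isUnit_iff_coprime n₁ q₁).1 (isUnit_of_mul_isUnit_left hu₁),
      (ZMod.isUnit_iff_coprime n₂ q₂).1 (isUnit_of_mul_isUnit_left hu₂), ?_⟩
    -- cast the two relations to `ZMod g`
    have e₁ : (b : ZMod g) * (a₂ : ZMod g) * (n₁ : ZMod g) = (a₁ : ZMod g) := by
      have := congrArg π₁ hb.1
      rw [map_mul, map_mul, hπ₁n, hπ₁n, hπ₁i, hπ₁i] at this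
      rw [← this]; ring
    have e₂ : (b : ZMod g) * (a₂ : ZMod g) * (n₂ : ZMod g) = (a₁ : ZMod g) := by
      have := congrArg π₂ hb.2
      rw [map_mul, map_mul, hπ₂n, hπ₂n, hπ₂i, hπ₂i] at this
      rw [← this]; ring
    have hu : IsUnit ((b : ZMod g) * (a₂ : ZMod g)) := by
      have ha₁g : IsUnit (a₁ : ZMod g) := by
        have := (RingHom.isUnit_map π₁ ha₁); rwa [hπ₁i] at this
      exact isUnit_of_mul_isUnit_left (e₁ ▸ ha₁g)
    exact (IsUnit.mul_right_inj hu).1 (e₁.trans e₂.symm)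

/-! ### The indicators -/

/-- `1_{m n ā₁ a₂ ≡ 1 (q)} = 1_{m (n a₂) ≡ a₁ (q)}` for `a₁` a unit modulo `q`. [folklore] -/
theorem ite_kerArg_eq_ite (a₁ a₂ : ℤ) {q : ℕ} (ha₁ : IsUnit (a₁ : ZMod q)) (m n : ℕ) :
    (if kerArg a₁ a₂ q m n = 1 then (1 : ℂ) else 0) =
      if (m : ZMod q) * ((n : ZMod q) * (a₂ : ZMod q)) = (a₁ : ZMod q) then 1 else 0 := by
  have key : kerArg a₁ a₂ q m n = 1 ↔ (m : ZMod q) * ((n : ZMod q) * (a₂ : ZMod q)) = (a₁ : ZMod q) := by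
    unfold kerArg
    push_cast
    constructor
    · intro h
      calc (m : ZMod q) * ((n : ZMod q) * (a₂ : ZMod q))
          = (m : ZMod q) * n * a₂ * (((a₁ : ZMod q))⁻¹ * (a₁ : ZMod q)) := by
            rw [ZMod.inv_mul_of_unit _ ha₁, mul_one]; ring
        _ = ((m : ZMod q) * n * ((a₁ : ZMod q))⁻¹ * (a₂ : ZMod q)) * (a₁ : ZMod q) := by ring
        _ = (a₁ : ZMod q) := by rw [h, one_mul]
    · intro h
      calc (m : ZMod q) * n * ((a₁ : ZMod q))⁻¹ * (a₂ : ZMod q)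
          = ((m : ZMod q) * ((n : ZMod q) * (a₂ : ZMod q))) * ((a₁ : ZMod q))⁻¹ := by ring
        _ = 1 := by rw [h, ZMod.mul_inv_of_unit _ ha₁]
  simp only [key]

/-- **Partition into classes modulo `[q₁,q₂]`**: for predicates on the residues modulo `q₁` and `q₂`,
`1_{P₁(m mod q₁)} 1_{P₂(m mod q₂)} = ∑_{b < W : P₁(b), P₂(b)} 1_{m ≡ b (W)}`, `W = [q₁,q₂]`. [folklore] -/
theorem ite_mul_ite_eq_sum_range {q₁ q₂ : ℕ} (hq₁ : 0 < q₁) (hq₂ : 0 < q₂) (P₁ : ZMod q₁ → Prop)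
    (P₂ : ZMod q₂ → Prop) [DecidablePred P₁] [DecidablePred P₂] (m : ℤ) :
    (if P₁ (m : ZMod q₁) then (1 : ℂ) else 0) * (if P₂ (m : ZMod q₂) then 1 else 0) =
      ∑ b ∈ Finset.range (Nat.lcm q₁ q₂), if (P₁ (b : ZMod q₁) ∧ P₂ (b : ZMod q₂)) then
        (if ((Nat.lcm q₁ q₂ : ℕ) : ℤ) ∣ m - b then 1 else 0) else 0 := by
  set W := Nat.lcm q₁ q₂ with hWdef
  have hW : 0 < W := Nat.lcm_pos hq₁ hq₂
  have hW0 : (W : ℤ) ≠ 0 := by exact_mod_cast hW.ne'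
  have hswap : ∀ b : ℕ, (if (P₁ (b : ZMod q₁) ∧ P₂ (b : ZMod q₂)) then
      (if (W : ℤ) ∣ m - b then (1 : ℂ) else 0) else 0) =
      if (W : ℤ) ∣ (b : ℤ) - m then (if (P₁ (b : ZMod q₁) ∧ P₂ (b : ZMod q₂)) then 1 else 0) else 0 := by
    intro b
    by_cases h1 : (P₁ (b : ZMod q₁) ∧ P₂ (b : ZMod q₂))
    · by_cases h2 : (W : ℤ) ∣ m - b
      · rw [if_pos h1, if_pos h2, if_pos (dvd_sub_comm.1 h2), if_pos h1]
      · rw [if_pos h1, if_neg h2, if_neg (fun h => h2 (dvd_sub_comm.1 h))]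
    · by_cases h2 : (W : ℤ) ∣ (b : ℤ) - m
      · rw [if_neg h1, if_pos h2, if_neg h1]
      · rw [if_neg h1, if_neg h2]
  simp_rw [hswap]
  rw [Polymath8a.sum_range_ite_dvd_sub hW m]
  -- the representative `b₀ = m mod W`
  set b₀ : ℕ := (m % (W : ℤ)).toNat with hb₀
  have hb₀Z : (b₀ : ℤ) = m % (W : ℤ) := Int.toNat_of_nonneg (Int.emod_nonneg _ hW0)
  have hcast : ∀ {q : ℕ}, q ∣ W → ((b₀ : ℕ) : ZMod q) = (m : ZMod q) := by
    intro q hq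
    rw [← Int.cast_natCast, hb₀Z, ZMod.intCast_eq_intCast_iff_dvd_sub]
    have e : m - m % (W : ℤ) = (W : ℤ) * (m / (W : ℤ)) := by
      have := Int.emod_add_mul_ediv m (W : ℤ); linarith
    rw [e]
    exact dvd_mul_of_dvd_left (Int.natCast_dvd_natCast.2 hq) _
  rw [hcast (Nat.dvd_lcm_left q₁ q₂), hcast (Nat.dvd_lcm_right q₁ q₂)]
  by_cases h1 : P₁ (m : ZMod q₁)
  · by_cases h2 : P₂ (m : ZMod q₂)
    · rw [if_pos h1, if_pos h2, if_pos ⟨h1, h2⟩, one_mul]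
    · rw [if_neg h2, if_neg (show ¬(P₁ (m : ZMod q₁) ∧ P₂ (m : ZMod q₂)) from fun h => h2 h.2),
        mul_zero]
  · rw [if_neg h1, if_neg (show ¬(P₁ (m : ZMod q₁) ∧ P₂ (m : ZMod q₂)) from fun h => h1 h.1),
      zero_mul]

/-! ### Poisson summation for the majorant along a progression -/

/-- **Poisson summation for `α = BFI.bump M (M/2)` along `m ≡ b (mod W)`** (`0 ≤ b < W`):
`∑_{m ≡ b (W)} α(m) = A₀/W + (M/W) ∑_{h ∈ ℤ∖Wℤ} ψ̂(Mh/W) e(bh/W)`, `A₀ = ∑_m α(m)`,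
`ψ = BFI.bumpC 1 (1/2)` (the frequencies `h ∈ Wℤ` are absorbed in `A₀`;
`Polymath8a.completion_identity`). [cite: Drappeau2017, §5.5] -/
theorem sum_mRange_bump_mul_ite_dvd_eq {M : ℝ} (hM : 0 < M) {W : ℕ} (hW : 0 < W) {b : ℕ}
    (hb : b < W) :
    ∑ m ∈ BFI.mRange M (M / 2), ((BFI.bump M (M / 2) m : ℝ) : ℂ) *
        (if (W : ℤ) ∣ (m : ℤ) - b then 1 else 0) =
      ((∑ m ∈ BFI.mRange M (M / 2), BFI.bump M (M / 2) m : ℝ) : ℂ) / W +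
        (M : ℂ) / W * ∑' h : ℤ, (if (W : ℤ) ∣ h then 0 else
          𝓕 (BFI.bumpC 1 (1 / 2)) (M * h / W) * (𝐞 ((b : ℝ) * h / W) : ℂ)) := by
  set ψ : ℝ → ℂ := BFI.bumpC 1 (1 / 2) with hψdef
  have hψ : ContDiff ℝ ∞ ψ := BFI.contDiff_bumpC 1 (1 / 2)
  have hψc : HasCompactSupport ψ := BFI.hasCompactSupport_bumpC (by norm_num) zero_le_one
  set g : ℤ → ℂ := fun k => if (W : ℤ) ∣ k - b then 1 else 0 with hg_def
  have hg : ∀ m n : ℤ, g (m + W * n) = g m := by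
    intro m n
    simp only [hg_def]
    rw [show m + W * n - b = W * n + (m - b) by ring]
    exact if_congr (dvd_add_right (dvd_mul_right _ _)) rfl rfl
  have h := Polymath8a.completion_identity hψ hψc hM 0 Nat.one_pos hW 0 hg
  simp only [one_mul, zero_add, Nat.cast_one, Int.cast_zero, Int.cast_natCast, zero_mul, zero_div,
    neg_zero, AddChar.map_zero_eq_one, Circle.coe_one] at h
  -- the pieces
  have hL : ∑' k : ℤ, ψ (((k : ℝ) - 0) / M) * g k =
      ∑ m ∈ BFI.mRange M (M / 2), ((BFI.bump M (M / 2) m : ℝ) : ℂ) *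
        (if (W : ℤ) ∣ (m : ℤ) - b then 1 else 0) := tsum_bumpC_mul_eq_sum_mRange hM g
  have hA : ∑' m : ℤ, ψ (((m : ℝ) - 0) / M) =
      ((∑ m ∈ BFI.mRange M (M / 2), BFI.bump M (M / 2) m : ℝ) : ℂ) := tsum_bumpC_eq_sum_mRange hM
  have h1 : ∑ j ∈ Finset.range W, g j = 1 := by
    simp only [hg_def]
    exact Polymath8a.sum_range_ite_dvd_sub hW (b : ℤ) (fun _ => (1 : ℂ))
  have hbW : ((b : ℤ) % (W : ℤ)).toNat = b := by
    rw [Int.emod_eq_of_lt (by positivity) (by exact_mod_cast hb), Int.toNat_natCast]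
  have h2 : ∀ hh : ℤ, ∑ j ∈ Finset.range W, g j * (𝐞 ((j : ℝ) * hh / W) : ℂ) =
      (𝐞 ((b : ℝ) * hh / W) : ℂ) := by
    intro hh
    simp only [hg_def, boole_mul]
    rw [Polymath8a.sum_range_ite_dvd_sub hW (b : ℤ) (fun j : ℕ => (𝐞 ((j : ℝ) * hh / W) : ℂ)), hbW]
  rw [hL, hA, h1, mul_one] at h
  rw [h]
  congr 1
  congr 1
  refine tsum_congr fun hh => ?_
  by_cases hdvd : (W : ℤ) ∣ hh
  · rw [if_pos hdvd, if_pos hdvd]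
  · rw [if_neg hdvd, if_neg hdvd, h2 hh]

/-! ### The `m`-sum of `𝒮₁` -/

/-- **Poisson summation for the `m`-sum of `𝒮₁`**: for `q₁, q₂ ≥ 1`, `a₁` a unit modulo `q₁` and
`q₂`, and `α = BFI.bump M (M/2)`,
`∑_m α(m) 1_{mn₁ā₁a₂≡1 (q₁)} 1_{mn₂ā₁a₂≡1 (q₂)} = ∑_{b<W : b n_ja₂ ≡ a₁ (q_j)} (A₀/W + (M/W) ∑_{h∉Wℤ} ψ̂(Mh/W) e(bh/W))`
(`W = [q₁,q₂]`; the `b`-sum has at most one term). [cite: Drappeau2017, §5.5] -/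
theorem msum_dispS1_eq {q₁ q₂ : ℕ} (hq₁ : 0 < q₁) (hq₂ : 0 < q₂) {a₁ a₂ : ℤ}
    (ha₁ : IsUnit (a₁ : ZMod q₁)) (ha₁' : IsUnit (a₁ : ZMod q₂)) (n₁ n₂ : ℕ) {M : ℝ} (hM : 0 < M) :
    ∑ m ∈ BFI.mRange M (M / 2), ((BFI.bump M (M / 2) m : ℝ) : ℂ) *
        (if kerArg a₁ a₂ q₁ m n₁ = 1 then 1 else 0) * (if kerArg a₁ a₂ q₂ m n₂ = 1 then 1 else 0) =
      ∑ b ∈ (Finset.range (Nat.lcm q₁ q₂)).filter (fun b : ℕ =>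
          (b : ZMod q₁) * ((n₁ : ZMod q₁) * (a₂ : ZMod q₁)) = (a₁ : ZMod q₁) ∧
          (b : ZMod q₂) * ((n₂ : ZMod q₂) * (a₂ : ZMod q₂)) = (a₁ : ZMod q₂)),
        (((∑ m ∈ BFI.mRange M (M / 2), BFI.bump M (M / 2) m : ℝ) : ℂ) / (Nat.lcm q₁ q₂ : ℂ) +
          (M : ℂ) / (Nat.lcm q₁ q₂ : ℂ) * ∑' h : ℤ, (if ((Nat.lcm q₁ q₂ : ℕ) : ℤ) ∣ h then 0 else
            𝓕 (BFI.bumpC 1 (1 / 2)) (M * h / (Nat.lcm q₁ q₂ : ℕ)) *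
              (𝐞 ((b : ℝ) * h / (Nat.lcm q₁ q₂ : ℕ)) : ℂ))) := by
  set W := Nat.lcm q₁ q₂ with hWdef
  have hW : 0 < W := Nat.lcm_pos hq₁ hq₂
  -- rewrite the indicators
  have hind : ∀ m : ℕ, ((BFI.bump M (M / 2) m : ℝ) : ℂ) *
      (if kerArg a₁ a₂ q₁ m n₁ = 1 then 1 else 0) * (if kerArg a₁ a₂ q₂ m n₂ = 1 then 1 else 0) =
      ∑ b ∈ Finset.range W, ((BFI.bump M (M / 2) m : ℝ) : ℂ) *
        (if ((b : ZMod q₁) * ((n₁ : ZMod q₁) * (a₂ : ZMod q₁)) = (a₁ : ZMod q₁) ∧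
            (b : ZMod q₂) * ((n₂ : ZMod q₂) * (a₂ : ZMod q₂)) = (a₁ : ZMod q₂)) then
          (if (W : ℤ) ∣ (m : ℤ) - b then 1 else 0) else 0) := by
    intro m
    rw [mul_assoc, ite_kerArg_eq_ite a₁ a₂ ha₁, ite_kerArg_eq_ite a₁ a₂ ha₁', ← Finset.mul_sum]
    congr 1
    have h := ite_mul_ite_eq_sum_range hq₁ hq₂
      (fun x : ZMod q₁ => x * ((n₁ : ZMod q₁) * (a₂ : ZMod q₁)) = (a₁ : ZMod q₁))
      (fun x : ZMod q₂ => x * ((n₂ : ZMod q₂) * (a₂ : ZMod q₂)) = (a₁ : ZMod q₂)) (m : ℤ)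
    simp only [Int.cast_natCast] at h
    exact h
  rw [Finset.sum_congr rfl fun m _ => hind m, Finset.sum_comm]
  -- now `∑_b ∑_m`
  rw [← Finset.sum_filter_add_sum_filter_not (Finset.range W) (fun b : ℕ =>
      (b : ZMod q₁) * ((n₁ : ZMod q₁) * (a₂ : ZMod q₁)) = (a₁ : ZMod q₁) ∧
      (b : ZMod q₂) * ((n₂ : ZMod q₂) * (a₂ : ZMod q₂)) = (a₁ : ZMod q₂))]
  rw [Finset.sum_eq_zero (s := (Finset.range W).filter (fun b : ℕ => ¬ (
      (b : ZMod q₁) * ((n₁ : ZMod q₁) * (a₂ : ZMod q₁)) = (a₁ : ZMod q₁) ∧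
      (b : ZMod q₂) * ((n₂ : ZMod q₂) * (a₂ : ZMod q₂)) = (a₁ : ZMod q₂)))), add_zero]
  swap
  · intro b hb
    have hb' := (Finset.mem_filter.1 hb).2
    refine Finset.sum_eq_zero fun m _ => ?_
    rw [if_neg hb', mul_zero]
  refine Finset.sum_congr rfl fun b hb => ?_
  have hbm := Finset.mem_filter.1 hb
  have hbW : b < W := Finset.mem_range.1 hbm.1
  rw [← sum_mRange_bump_mul_ite_dvd_eq hM hW hbW]
  refine Finset.sum_congr rfl fun m _ => ?_
  rw [if_pos hbm.2]

/-! ### `𝒮₁ = A₀ X₁ + (frequencies)` -/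

/-- Units modulo `q` from the coprimality filter `(q, a₁a₂) = 1`. [folklore] -/
theorem isUnit_of_isCoprime_mul {q : ℕ} {a₁ a₂ : ℤ} (h : IsCoprime (q : ℤ) (a₁ * a₂)) :
    IsUnit (a₁ : ZMod q) ∧ IsUnit (a₂ : ZMod q) :=
  ⟨(ZMod.coe_int_isUnit_iff_isCoprime a₁ q).2 h.of_mul_right_left,
    (ZMod.coe_int_isUnit_iff_isCoprime a₂ q).2 h.of_mul_right_right⟩

/-- Bookkeeping: `∑_{n₁,n₂ ∈ S} F(n₁,n₂) C 1_{P₁(n₁) ∧ P₂(n₂) ∧ P₃(n₁,n₂)}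
= C ∑_{n₁ ∈ S, P₁} ∑_{n₂ ∈ S, P₂} 1_{P₃} F`. [folklore] -/
theorem sum_sum_mul_ite_and_eq (S : Finset ℕ) (F : ℕ → ℕ → ℂ) (C : ℂ) (P₁ P₂ : ℕ → Prop)
    [DecidablePred P₁] [DecidablePred P₂] (P₃ : ℕ → ℕ → Prop) [∀ a b, Decidable (P₃ a b)] :
    ∑ n₁ ∈ S, ∑ n₂ ∈ S, F n₁ n₂ * (C * if (P₁ n₁ ∧ P₂ n₂ ∧ P₃ n₁ n₂) then 1 else 0) =
      C * ∑ n₁ ∈ S.filter P₁, ∑ n₂ ∈ S.filter P₂, if P₃ n₁ n₂ then F n₁ n₂ else 0 := by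
  rw [Finset.mul_sum, Finset.sum_filter]
  refine Finset.sum_congr rfl fun n₁ _ => ?_
  by_cases h₁ : P₁ n₁
  · rw [if_pos h₁, Finset.mul_sum, Finset.sum_filter]
    refine Finset.sum_congr rfl fun n₂ _ => ?_
    by_cases h₂ : P₂ n₂
    · rw [if_pos h₂]
      by_cases h₃ : P₃ n₁ n₂
      · rw [if_pos ⟨h₁, h₂, h₃⟩, if_pos h₃]; ring
      · rw [if_neg (show ¬(P₁ n₁ ∧ P₂ n₂ ∧ P₃ n₁ n₂) from fun h => h₃ h.2.2), if_neg h₃]; ring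
    · rw [if_neg h₂, if_neg (show ¬(P₁ n₁ ∧ P₂ n₂ ∧ P₃ n₁ n₂) from fun h => h₂ h.2.1)]; ring
  · rw [if_neg h₁]
    refine Finset.sum_eq_zero fun n₂ _ => ?_
    rw [if_neg (show ¬(P₁ n₁ ∧ P₂ n₂ ∧ P₃ n₁ n₂) from fun h => h₁ h.1)]; ring

/-- **Drappeau 2017, §5.4–5.5: `𝒮₁ = α̂(0)X₁ + ℛ₁` (exact form, all non-zero frequencies).**
For moduli `𝒬 ⊆ ℕ_{≥1}`, the `m`-range `BFI.mRange M (M/2)` with the majorant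
`α = BFI.bump M (M/2)` (`M > 0`), `A₀ = ∑_m α(m)` and `ψ = BFI.bumpC 1 (1/2)` (`α(m) = ψ(m/M)`):
`𝒮₁ = A₀·X₁ + ∑_{q₁,q₂ ∈ 𝒬, (q_j,a₁a₂)=1} γ(q₁)γ(q₂) ∑_{n₁,n₂ ∈ 𝒩, (n_j,a₂)=1} β_{n₁}β̄_{n₂}
  (M/W) ∑_{b<W : b n_ja₂ ≡ a₁ (q_j)} ∑_{h ∈ ℤ∖Wℤ} ψ̂(Mh/W) e(bh/W)`, `W = [q₁,q₂]`
(`𝒮₁ = dispS1`, `X₁ = mainX1`; the `b`-sum is the single class `μ` of §5.5 when `(n_j,q_j) = 1` and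
`n₁ ≡ n₂ ((q₁,q₂))`, and empty otherwise). [cite: Drappeau2017, §5.4 (5.20), §5.5] -/
theorem dispS1_eq_mainX1_add_freq (a₁ a₂ : ℤ) {𝒬 : Finset ℕ} (h𝒬 : ∀ q ∈ 𝒬, 0 < q)
    (𝒩 : Finset ℕ) (γ : ℕ → ℝ) (β : ℕ → ℂ) {M : ℝ} (hM : 0 < M) :
    dispS1 a₁ a₂ 𝒬 (BFI.mRange M (M / 2)) 𝒩 γ (fun m : ℕ => BFI.bump M (M / 2) m) β =
      ((∑ m ∈ BFI.mRange M (M / 2), BFI.bump M (M / 2) m : ℝ) : ℂ) * mainX1 a₁ a₂ 𝒬 𝒩 γ β +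
      ∑ q₁ ∈ 𝒬.filter (fun q : ℕ => IsCoprime (q : ℤ) (a₁ * a₂)),
        ∑ q₂ ∈ 𝒬.filter (fun q : ℕ => IsCoprime (q : ℤ) (a₁ * a₂)), (γ q₁ : ℂ) * (γ q₂ : ℂ) *
          ∑ n₁ ∈ 𝒩.filter (fun n : ℕ => IsCoprime (n : ℤ) a₂),
            ∑ n₂ ∈ 𝒩.filter (fun n : ℕ => IsCoprime (n : ℤ) a₂), β n₁ * starRingEnd ℂ (β n₂) *
              ((M : ℂ) / (Nat.lcm q₁ q₂ : ℂ) *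
                ∑ b ∈ (Finset.range (Nat.lcm q₁ q₂)).filter (fun b : ℕ =>
                    (b : ZMod q₁) * ((n₁ : ZMod q₁) * (a₂ : ZMod q₁)) = (a₁ : ZMod q₁) ∧
                    (b : ZMod q₂) * ((n₂ : ZMod q₂) * (a₂ : ZMod q₂)) = (a₁ : ZMod q₂)),
                  ∑' h : ℤ, (if ((Nat.lcm q₁ q₂ : ℕ) : ℤ) ∣ h then 0 else
                    𝓕 (BFI.bumpC 1 (1 / 2)) (M * h / (Nat.lcm q₁ q₂ : ℕ)) *
                      (𝐞 ((b : ℝ) * h / (Nat.lcm q₁ q₂ : ℕ)) : ℂ))) := by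
  simp only [dispS1, mainX1]
  rw [Finset.mul_sum, ← Finset.sum_add_distrib]
  refine Finset.sum_congr rfl fun q₁ hq₁ => ?_
  rw [Finset.mul_sum, ← Finset.sum_add_distrib]
  refine Finset.sum_congr rfl fun q₂ hq₂ => ?_
  have hq₁m := Finset.mem_filter.1 hq₁
  have hq₂m := Finset.mem_filter.1 hq₂
  have hq₁0 : 0 < q₁ := h𝒬 q₁ hq₁m.1
  have hq₂0 : 0 < q₂ := h𝒬 q₂ hq₂m.1
  obtain ⟨ha₁, ha₂⟩ := isUnit_of_isCoprime_mul hq₁m.2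
  obtain ⟨ha₁', ha₂'⟩ := isUnit_of_isCoprime_mul hq₂m.2
  have hW : 0 < Nat.lcm q₁ q₂ := Nat.lcm_pos hq₁0 hq₂0
  have hWc : ((Nat.lcm q₁ q₂ : ℕ) : ℂ) ≠ 0 := by exact_mod_cast hW.ne'
  -- the `m`-sums
  have hms : ∀ n₁ n₂ : ℕ, ∑ m ∈ BFI.mRange M (M / 2), ((BFI.bump M (M / 2) m : ℝ) : ℂ) *
      (if kerArg a₁ a₂ q₁ m n₁ = 1 then 1 else 0) * (if kerArg a₁ a₂ q₂ m n₂ = 1 then 1 else 0) =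
      ((∑ m ∈ BFI.mRange M (M / 2), BFI.bump M (M / 2) m : ℝ) : ℂ) / (Nat.lcm q₁ q₂ : ℂ) *
        (if (n₁.Coprime q₁ ∧ n₂.Coprime q₂ ∧
          (n₁ : ZMod (Nat.gcd q₁ q₂)) = (n₂ : ZMod (Nat.gcd q₁ q₂))) then 1 else 0) +
      (M : ℂ) / (Nat.lcm q₁ q₂ : ℂ) * ∑ b ∈ (Finset.range (Nat.lcm q₁ q₂)).filter (fun b : ℕ =>
          (b : ZMod q₁) * ((n₁ : ZMod q₁) * (a₂ : ZMod q₁)) = (a₁ : ZMod q₁) ∧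
          (b : ZMod q₂) * ((n₂ : ZMod q₂) * (a₂ : ZMod q₂)) = (a₁ : ZMod q₂)),
        ∑' h : ℤ, (if ((Nat.lcm q₁ q₂ : ℕ) : ℤ) ∣ h then 0 else
          𝓕 (BFI.bumpC 1 (1 / 2)) (M * h / (Nat.lcm q₁ q₂ : ℕ)) *
            (𝐞 ((b : ℝ) * h / (Nat.lcm q₁ q₂ : ℕ)) : ℂ)) := by
    intro n₁ n₂
    rw [msum_dispS1_eq hq₁0 hq₂0 ha₁ ha₁' n₁ n₂ hM, Finset.sum_add_distrib, Finset.sum_const,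
      nsmul_eq_mul, card_range_lcm_filter_eq hq₁0 hq₂0 ha₁ ha₁' ha₂ ha₂' n₁ n₂, ← Finset.mul_sum]
    congr 1
    rw [Nat.cast_ite, Nat.cast_one, Nat.cast_zero, mul_comm]
  -- assemble the `n`-sums
  have hsum : ∑ n₁ ∈ 𝒩.filter (fun n : ℕ => IsCoprime (n : ℤ) a₂),
      ∑ n₂ ∈ 𝒩.filter (fun n : ℕ => IsCoprime (n : ℤ) a₂), β n₁ * starRingEnd ℂ (β n₂) *
        ∑ m ∈ BFI.mRange M (M / 2), (((fun m : ℕ => BFI.bump M (M / 2) m) m : ℝ) : ℂ) *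
          (if kerArg a₁ a₂ q₁ m n₁ = 1 then 1 else 0) * (if kerArg a₁ a₂ q₂ m n₂ = 1 then 1 else 0) =
      ((∑ m ∈ BFI.mRange M (M / 2), BFI.bump M (M / 2) m : ℝ) : ℂ) / (Nat.lcm q₁ q₂ : ℂ) *
        ∑ n₁ ∈ (𝒩.filter (fun n : ℕ => IsCoprime (n : ℤ) a₂)).filter (fun n => n.Coprime q₁),
          ∑ n₂ ∈ (𝒩.filter (fun n : ℕ => IsCoprime (n : ℤ) a₂)).filter (fun n => n.Coprime q₂),
            (if (n₁ : ZMod (Nat.gcd q₁ q₂)) = (n₂ : ZMod (Nat.gcd q₁ q₂)) then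
              β n₁ * starRingEnd ℂ (β n₂) else 0) +
      ∑ n₁ ∈ 𝒩.filter (fun n : ℕ => IsCoprime (n : ℤ) a₂),
        ∑ n₂ ∈ 𝒩.filter (fun n : ℕ => IsCoprime (n : ℤ) a₂), β n₁ * starRingEnd ℂ (β n₂) *
          ((M : ℂ) / (Nat.lcm q₁ q₂ : ℂ) *
            ∑ b ∈ (Finset.range (Nat.lcm q₁ q₂)).filter (fun b : ℕ =>
                (b : ZMod q₁) * ((n₁ : ZMod q₁) * (a₂ : ZMod q₁)) = (a₁ : ZMod q₁) ∧
                (b : ZMod q₂) * ((n₂ : ZMod q₂) * (a₂ : ZMod q₂)) = (a₁ : ZMod q₂)),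
              ∑' h : ℤ, (if ((Nat.lcm q₁ q₂ : ℕ) : ℤ) ∣ h then 0 else
                𝓕 (BFI.bumpC 1 (1 / 2)) (M * h / (Nat.lcm q₁ q₂ : ℕ)) *
                  (𝐞 ((b : ℝ) * h / (Nat.lcm q₁ q₂ : ℕ)) : ℂ))) := by
    rw [← sum_sum_mul_ite_and_eq, ← Finset.sum_add_distrib]
    refine Finset.sum_congr rfl fun n₁ _ => ?_
    rw [← Finset.sum_add_distrib]
    refine Finset.sum_congr rfl fun n₂ _ => ?_
    rw [← mul_add, ← hms n₁ n₂]
  rw [hsum, mul_add]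
  congr 1
  push_cast
  field_simp

end Drappeau2017

end Literature.NumberTheory.Sieve

end
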